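import Summits.AtomisticToContinuum.Crystallization.Theorems.ChartedZeroExcessLayeredLatticeLiouvilleZZZYRCZ
import Summits.AtomisticToContinuum.Crystallization.Theorems.ChartedZeroExcessLayeredLatticeLiouvilleZZZYRCZO

/-!
# Charted zero-excess layered-lattice Liouville — ZZZYRCZQ: LETTER LOCALITY and the WINDOW WORD of a letter sequence (item 5c)

Cell `decomp-a2c`, lens 2, generation 100.  The repair of record for «APERIODIC-COVER» (r1864 (A)(2), option (i)) indexes the atlas by
LETTER WINDOWS: a box `(ω, β)` fixes the letters of `ℓ` only on a window of layers `[m₀, m₀ + N)` (`N = 2H₀ + 1` around the certified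
layer) and every per-box obligation must READ LETTERS ONLY INSIDE the window.  This file supplies the three generic facts that make
such obligations well defined and let them be discharged by the landed PERIODIC machinery (ZZZYRCX…ZZZYRCZM) run on the window word:

§1 LOCALITY — `n9F ℓ x`, `d18F ℓ x q`, `sinSq0F ℓ x q` depend on `ℓ` only through the letters at the endpoint layers of the pairs
   (`n9F_eq_of_letters`, `d18F_eq_of_letters`, `sinSq0F_eq_of_letters`);
§2 SHIFTS — a common translation of the pair (`shiftPairW`, ZZZYRCZ) is a shift of the letter sequence (`n9F_shift`, `d18F_shift`,
   `sinSq0F_shift`);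
§3 THE WINDOW WORD `windowWord ℓ m₀ N = [ℓ m₀, …, ℓ (m₀+N−1)]`: `regW (windowWord ℓ m₀ N) j = ℓ (m₀ + j)` for `0 ≤ j < N`, its letters
   are in `{0,1,2}` when `ℓ`'s are, and ★ `n9F_window` / `d18F_window` / `sinSq0F_window`: on pairs INSIDE the window the ideal geometry
   of `ℓ` is that of the periodic word `windowWord ℓ m₀ N` on the pairs translated to base layer `0` — so the word-indexed ideal tables
   of ZZZYRCX (`thetaR0/thetaN0`, keyed by `pieceKeyW`) evaluate the in-window part of a letter-window box verbatim.
Pairs leaving the window are the LETTER-FREE remainder of the window split (bounded per height class by the far-far device; hand-1's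
windowed kernel RCXR after census «WINDOW-SPLIT-57» fixes `H₀`).
-/

namespace Summit.AtomisticToContinuum.Crystallization.Theorems.ChartedZeroExcessLayeredLatticeLiouville

open Summit.AtomisticToContinuum.Crystallization.Theorems.ChartedPlanarOrderRigidityDoor (E3)

/-! ### §1 letter locality -/

/-- `n9F ℓ x` reads only the letters at the two layers of `x`. [g100] -/
theorem n9F_eq_of_letters {ℓ ℓ' : ℤ → ℤ} {x : (Cell 2 × ℤ) × (Cell 2 × ℤ)} (h₁ : ℓ x.1.2 = ℓ' x.1.2) (h₂ : ℓ x.2.2 = ℓ' x.2.2) :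
    n9F ℓ x = n9F ℓ' x := by
  simp only [n9F, refF0, refF1, h₁, h₂]

/-- `d18F ℓ x q` reads only the letters at the four layers of `x`, `q`. [g100] -/
theorem d18F_eq_of_letters {ℓ ℓ' : ℤ → ℤ} {x q : (Cell 2 × ℤ) × (Cell 2 × ℤ)} (h₁ : ℓ x.1.2 = ℓ' x.1.2) (h₂ : ℓ x.2.2 = ℓ' x.2.2)
    (h₃ : ℓ q.1.2 = ℓ' q.1.2) (h₄ : ℓ q.2.2 = ℓ' q.2.2) : d18F ℓ x q = d18F ℓ' x q := by
  simp only [d18F, refF0, refF1, h₁, h₂, h₃, h₄]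

/-- `sinSq0F ℓ x q` reads only the letters at the four layers of `x`, `q`. [g100] -/
theorem sinSq0F_eq_of_letters {ℓ ℓ' : ℤ → ℤ} {x q : (Cell 2 × ℤ) × (Cell 2 × ℤ)} (h₁ : ℓ x.1.2 = ℓ' x.1.2) (h₂ : ℓ x.2.2 = ℓ' x.2.2)
    (h₃ : ℓ q.1.2 = ℓ' q.1.2) (h₄ : ℓ q.2.2 = ℓ' q.2.2) : sinSq0F ℓ x q = sinSq0F ℓ' x q := by
  simp only [sinSq0F, n9F_eq_of_letters h₁ h₂, n9F_eq_of_letters h₃ h₄, d18F_eq_of_letters h₁ h₂ h₃ h₄]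

/-! ### §2 translations of the pair are shifts of the letter sequence -/

/-- `n9F` of a translated pair = `n9F` of the shifted letter sequence. [g100] -/
theorem n9F_shift (ℓ : ℤ → ℤ) (γ : Cell 2) (c : ℤ) (x : (Cell 2 × ℤ) × (Cell 2 × ℤ)) :
    n9F ℓ (shiftPairW γ c x) = n9F (fun j => ℓ (j + c)) x := by
  simp only [n9F, refF0, refF1, shiftPairW, shiftSiteW, Pi.add_apply]; ring

/-- `d18F` of translated pairs = `d18F` of the shifted letter sequence. [g100] -/
theorem d18F_shift (ℓ : ℤ → ℤ) (γ : Cell 2) (c : ℤ) (x q : (Cell 2 × ℤ) × (Cell 2 × ℤ)) :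
    d18F ℓ (shiftPairW γ c x) (shiftPairW γ c q) = d18F (fun j => ℓ (j + c)) x q := by
  simp only [d18F, refF0, refF1, shiftPairW, shiftSiteW, Pi.add_apply]; ring

/-- `sinSq0F` of translated pairs = `sinSq0F` of the shifted letter sequence. [g100] -/
theorem sinSq0F_shift (ℓ : ℤ → ℤ) (γ : Cell 2) (c : ℤ) (x q : (Cell 2 × ℤ) × (Cell 2 × ℤ)) :
    sinSq0F ℓ (shiftPairW γ c x) (shiftPairW γ c q) = sinSq0F (fun j => ℓ (j + c)) x q := by
  simp only [sinSq0F, n9F_shift, d18F_shift]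

/-- layer components of a translated pair. [g100] -/
theorem shiftPairW_layers (γ : Cell 2) (c : ℤ) (x : (Cell 2 × ℤ) × (Cell 2 × ℤ)) :
    (shiftPairW γ c x).1.2 = x.1.2 + c ∧ (shiftPairW γ c x).2.2 = x.2.2 + c := ⟨rfl, rfl⟩

/-! ### §3 the window word -/

/-- THE WINDOW WORD: the letters of `ℓ` on the layers `m₀, …, m₀ + N − 1`. [g100] -/
def windowWord (ℓ : ℤ → ℤ) (m₀ : ℤ) (N : ℕ) : List ℤ := (List.range N).map fun j : ℕ => ℓ (m₀ + (j : ℤ))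

/-- the window word has length `N`. [g100] -/
theorem windowWord_length (ℓ : ℤ → ℤ) (m₀ : ℤ) (N : ℕ) : (windowWord ℓ m₀ N).length = N := by
  simp [windowWord]

/-- the window word of a letter sequence is a `{0,1,2}`-word. [g100] -/
theorem windowWord_letters {ℓ : ℤ → ℤ} (h : IsLetterSeq ℓ) (m₀ : ℤ) (N : ℕ) : ∀ c ∈ windowWord ℓ m₀ N, 0 ≤ c ∧ c ≤ 2 := by
  intro c hc
  simp only [windowWord, List.mem_map] at hc
  obtain ⟨j, -, rfl⟩ := hc
  exact h _

/-- hence its periodic extension is a letter sequence. [g100] -/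
theorem isLetterSeq_regW_windowWord {ℓ : ℤ → ℤ} (h : IsLetterSeq ℓ) (m₀ : ℤ) (N : ℕ) :
    IsLetterSeq (regW (windowWord ℓ m₀ N)) :=
  isLetterSeq_regW (windowWord_letters h m₀ N)

/-- ★ inside the window the periodic extension of the window word IS the letter sequence: `regW (windowWord ℓ m₀ N) j = ℓ (m₀ + j)`
for `0 ≤ j < N`. [g100] -/
theorem regW_windowWord (ℓ : ℤ → ℤ) (m₀ : ℤ) {N : ℕ} {j : ℤ} (h0 : 0 ≤ j) (hj : j < (N : ℤ)) :
    regW (windowWord ℓ m₀ N) j = ℓ (m₀ + j) := by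
  obtain ⟨i, rfl⟩ : ∃ i : ℕ, (i : ℤ) = j := ⟨j.toNat, Int.toNat_of_nonneg h0⟩
  have hi : i < N := by exact_mod_cast hj
  have hi' : i < (windowWord ℓ m₀ N).length := by rwa [windowWord_length]
  unfold regW
  rw [windowWord_length, Int.emod_eq_of_lt h0 hj, Int.toNat_natCast, List.getD_eq_getElem _ _ hi']
  simp only [windowWord, List.getElem_map, List.getElem_range]

/-- a layer inside the window, re-based at `m₀`, reads the same letter from the window word. [g100] -/
theorem regW_windowWord_sub (ℓ : ℤ → ℤ) {m₀ : ℤ} {N : ℕ} {m : ℤ} (h0 : m₀ ≤ m) (hN : m < m₀ + N) :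
    regW (windowWord ℓ m₀ N) (m + -m₀) = ℓ m := by
  rw [regW_windowWord ℓ m₀ (by linarith) (by linarith)]; congr 1; ring

/-- ★ WINDOW TRANSFER for `n9F`: on a pair inside the window `[m₀, m₀+N)`, the ideal length of `ℓ` is that of the window word on the
pair translated to base layer `0`. [g100] -/
theorem n9F_window (ℓ : ℤ → ℤ) {m₀ : ℤ} {N : ℕ} (γ : Cell 2) {x : (Cell 2 × ℤ) × (Cell 2 × ℤ)} (h₁ : m₀ ≤ x.1.2)
    (h₁' : x.1.2 < m₀ + N) (h₂ : m₀ ≤ x.2.2) (h₂' : x.2.2 < m₀ + N) :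
    n9W (windowWord ℓ m₀ N) (shiftPairW γ (-m₀) x) = n9F ℓ x := by
  rw [← n9F_regW, n9F_shift]
  exact n9F_eq_of_letters (regW_windowWord_sub ℓ h₁ h₁') (regW_windowWord_sub ℓ h₂ h₂')

/-- ★ WINDOW TRANSFER for `d18F`. [g100] -/
theorem d18F_window (ℓ : ℤ → ℤ) {m₀ : ℤ} {N : ℕ} (γ : Cell 2) {x q : (Cell 2 × ℤ) × (Cell 2 × ℤ)} (h₁ : m₀ ≤ x.1.2)
    (h₁' : x.1.2 < m₀ + N) (h₂ : m₀ ≤ x.2.2) (h₂' : x.2.2 < m₀ + N) (h₃ : m₀ ≤ q.1.2) (h₃' : q.1.2 < m₀ + N) (h₄ : m₀ ≤ q.2.2)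
    (h₄' : q.2.2 < m₀ + N) :
    d18W (windowWord ℓ m₀ N) (shiftPairW γ (-m₀) x) (shiftPairW γ (-m₀) q) = d18F ℓ x q := by
  rw [← d18F_regW, d18F_shift]
  exact d18F_eq_of_letters (regW_windowWord_sub ℓ h₁ h₁') (regW_windowWord_sub ℓ h₂ h₂') (regW_windowWord_sub ℓ h₃ h₃')
    (regW_windowWord_sub ℓ h₄ h₄')

/-- ★ WINDOW TRANSFER for the ideal `sin²`. [g100] -/
theorem sinSq0F_window (ℓ : ℤ → ℤ) {m₀ : ℤ} {N : ℕ} (γ : Cell 2) {x q : (Cell 2 × ℤ) × (Cell 2 × ℤ)} (h₁ : m₀ ≤ x.1.2)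
    (h₁' : x.1.2 < m₀ + N) (h₂ : m₀ ≤ x.2.2) (h₂' : x.2.2 < m₀ + N) (h₃ : m₀ ≤ q.1.2) (h₃' : q.1.2 < m₀ + N) (h₄ : m₀ ≤ q.2.2)
    (h₄' : q.2.2 < m₀ + N) :
    sinSq0 (windowWord ℓ m₀ N) (shiftPairW γ (-m₀) x) (shiftPairW γ (-m₀) q) = sinSq0F ℓ x q := by
  rw [← sinSq0F_regW, sinSq0F_shift]
  exact sinSq0F_eq_of_letters (regW_windowWord_sub ℓ h₁ h₁') (regW_windowWord_sub ℓ h₂ h₂') (regW_windowWord_sub ℓ h₃ h₃')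
    (regW_windowWord_sub ℓ h₄ h₄')

/-- the piece key of a re-based in-window pair: `(x.1.2 − m₀, Δγ₀, Δγ₁, Δm)` when `N` exceeds the window (no wrap). [g100] -/
theorem pieceKeyW_window (γ : Cell 2) {m₀ : ℤ} {N : ℕ} {x : (Cell 2 × ℤ) × (Cell 2 × ℤ)} (h₁ : m₀ ≤ x.1.2)
    (h₁' : x.1.2 < m₀ + N) :
    pieceKeyW N (shiftPairW γ (-m₀) x) = (x.1.2 - m₀, x.2.1 0 - x.1.1 0, x.2.1 1 - x.1.1 1, x.2.2 - x.1.2) := by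
  simp only [pieceKeyW, shiftPairW, shiftSiteW, Pi.add_apply]
  refine Prod.ext ?_ (Prod.ext ?_ (Prod.ext ?_ ?_))
  · exact (Int.emod_eq_of_lt (by linarith) (by linarith)).trans (by ring)
  · simp only; ring
  · simp only; ring
  · simp only; ring

end Summit.AtomisticToContinuum.Crystallization.Theorems.ChartedZeroExcessLayeredLatticeLiouville
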